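import Summits.NavierStokesRegularity.NavierStokesRegularity.Theses.RellichScar
import Summits.NavierStokesRegularity.NavierStokesRegularity.Theorems.SymmetricScarExists.Negative.SpiralWorld
import Summits.NavierStokesRegularity.NavierStokesRegularity.Theorems.SymmetricScarExists.Negative.RepairedAssembly
import Summits.NavierStokesRegularity.NavierStokesRegularity.Theorems.RellichScarScarRigidityApexMild
import Summits.NavierStokesRegularity.NavierStokesRegularity.Theorems.RellichScarScarRigidityApexBounds
import Summits.NavierStokesRegularity.NavierStokesRegularity.Theorems.RellichScarSymmetricScarExistsScarDefectLimit
import Summits.NavierStokesRegularity.NavierStokesRegularity.Theorems.RellichScarSymmetricScarExistsSmallConstant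
import Literature.Analysis.FluidPDE.PineauVicolRSSHolds
import Literature.Analysis.FluidPDE.LocalTypeI
import Literature.Analysis.FluidPDE.TypeIAncientMild

/-!
# Crux `SymmetricScarExists` (stmt-NavierStokesRegularity-11718): no rotated-self-similar singular apex profile of small or large pitch

Helper file of the line lead (continuation lead c2; `--supports stmt-NavierStokesRegularity-11718`; theorems only,
no definitions, no named-fact hypotheses).  The crux's dichotomy "(−1)-homogeneous scar ∨ axisymmetric scar" omits
a third one-parameter subgroup of `ℝ₊ × SO(2)` — the SPIRAL scars of Perelman's rotated self-similar (RSS) ansatz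
(`Negative/SpiralWorld`, Disproof §4–§5; Pineau–Vicol 2026, (1.6)–(1.7)) — and the crux disprover's REPAIRED
crux `SymmetricScarExistsSpiral` needs the Fatal support `Negative.RssApexFatal α` for every pitch `α`
(`Negative/RepairedAssembly`, `noApexTypeIProfile_of_repaired`); `α = 0` is Tsai's theorem
(`rssApexFatal_zero_iff`, `rellichScar_selfSimilarApexFatal_proof`), `α ≈ 1` is Perelman's open problem
(Pineau–Vicol 2026, Conj. 1.1).  This file lands the two ends of the pitch axis in the apex class, from the tree's
discharged Pineau–Vicol Theorem 1.4 (`pineauVicol2026_rss_liouville_holds`):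

* `rssApexFatal_smallOrLargePitch` (registered auxiliary stub): for every `C > 0` there are `α₁, α₂ > 0`
  (Pineau–Vicol's `α_(C)`, `ᾱ(C)`) such that for `|α| < α₁` or `|α| > α₂` NO suitable weak solution on the slab
  with a weak gradient, `𝐈 < ∞` and the apex bound of constant `C`, singular at the origin, is a.e. `α`-RSS in
  group form (`R_{2α log λ} D_λ u = u` a.e. on the slab for every `λ > 0` — the hypothesis of `RssApexFatal α`,
  verbatim).  Proof: the profile is a.e. a Type-I ancient mild field `V` (`stub_apexMildRepresentative`),
  classical on `(−∞, 0)` for some smooth pressure (`exists_isClassicalNSSolutionOn_Iio`); the a.e. RSS identities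
  transport to `V` (`conjZ_ae_eq_slab ∘ nsRescale_ae_eq_slab`) and hold pointwise on the open slab by continuity
  (`Measure.eqOn_open_of_ae_eq`); choosing `λ = (−t)^{−1/2}` writes `V` as Pineau–Vicol's ansatz `pvAnsatz α U`
  with the `C^∞` profile `U = V(−1, ·)` (`rss_pointwise_eq_pvAnsatz`); Theorem 1.4 on `[−1, 0)` gives `U ≡ 0`,
  the ansatz then `V ≡ 0` on `t < 0`, so `u = 0` a.e. on the slab and the origin is not singular
  (`not_isBackwardSingularPoint_of_ae_zero_slab`).
* `spiralWorld_pitch_window`: contrapositive for the planners — a singular apex `α`-RSS profile with constant `C`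
  (the scenario of Disproof §4 in which the crux FAILS) has its pitch confined to the compact band
  `α₁(C) ≤ |α| ≤ α₂(C)`.

References: B. Pineau, V. Vicol, *On rotated backwards self-similar solutions of the incompressible 3D
Navier–Stokes equations*, arXiv:2607.09619 (2026), Theorem 1.4 p. 4, (1.7) p. 3, Conjecture 1.1 [PineauVicol2026];
D. Chae, J. Wolf, Comm. PDE 42 (2017) = arXiv:1610.09464, Thm 1.3 [ChaeWolf2017RemovingDSS]; G. Koch,
N. Nadirashvili, G. Seregin, V. Šverák, Acta Math. 203 (2009), Lemma 3.1, Prop. 4.1 [KNSS2009].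
-/

noncomputable section

open MeasureTheory Set Function Filter Topology TopologicalSpace Metric
open scoped NNReal ENNReal

namespace Summit.NavierStokesRegularity.NavierStokesRegularity.Theorems.SymmetricScarExists.ScarWindow

open Literature.Analysis.FluidPDE
open Summit.NavierStokesRegularity.NavierStokesRegularity.Theses.RellichScar
open Summit.NavierStokesRegularity.NavierStokesRegularity.Theorems.SymmetricScarExists.Negative
open Summit.NavierStokesRegularity.NavierStokesRegularity.Theorems.RellichScarScarRigidity
  (stub_apexMildRepresentative exists_isClassicalNSSolutionOn_Iio)

set_option linter.dupNamespace false

/-- **An everywhere-RSS field is Pineau–Vicol's ansatz of its own `t = −1` slice.**  If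
`R_{2α log λ}(λ V(λ²t, λ R_{−2α log λ} x)) = V(t, x)` for all `λ > 0`, `t < 0`, `x`, then
`V(t, x) = (−t)^{−1/2} R(αs) U(R(−αs) x/√(−t))` with `s = −log(−t)` and `U = V(−1, ·)`: take
`λ = (−t)^{−1/2}`. [cite: PineauVicol2026, (1.7) and Remark 1.3 (arXiv:2607.09619 p. 3)] -/
theorem rss_pointwise_eq_pvAnsatz {α : ℝ} {V : ℝ → EuclideanSpace ℝ (Fin 3) → EuclideanSpace ℝ (Fin 3)}
    (h : ∀ lam : ℝ, 0 < lam → ∀ t : ℝ, t < 0 → ∀ x : EuclideanSpace ℝ (Fin 3),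
      conjZ (2 * α * Real.log lam) (nsRescale lam V) t x = V t x)
    {t : ℝ} (ht : t < 0) (x : EuclideanSpace ℝ (Fin 3)) :
    V t x = pvAnsatz α (fun y _ => V (-1) y) t x := by
  have hnt : 0 < -t := neg_pos.2 ht
  have hsq : 0 < Real.sqrt (-t) := Real.sqrt_pos.2 hnt
  set lam : ℝ := (Real.sqrt (-t))⁻¹ with hlam_def
  have hlam : 0 < lam := inv_pos.2 hsq
  have hlam2 : lam ^ 2 * t = -1 := by
    rw [hlam_def, inv_pow, Real.sq_sqrt hnt.le, inv_mul_eq_div, div_neg, div_self ht.ne]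
  have hθ : 2 * α * Real.log lam = α * -Real.log (-t) := by
    rw [hlam_def, Real.log_inv, Real.log_sqrt hnt.le]
    ring
  have key := h lam hlam t ht x
  rw [← key]
  simp only [conjZ, nsRescale_apply, pvAnsatz, hlam2, hθ, rotZ_smul', ← hlam_def]

/-- **No rotated-self-similar singular apex profile of small or large pitch** (registered auxiliary stub
`rssApexFatal_smallOrLargePitch` of crux stmt-NavierStokesRegularity-11718; Pineau–Vicol 2026 Thm 1.4 in the apex
class).  For every `C > 0` there are `α₁, α₂ > 0` such that for `|α| < α₁` or `α₂ < |α|` no suitable weak solution on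
the slab with a weak gradient, `𝐈 < ∞` and the apex bound `‖u‖ ≤ C/(‖x‖ + √(−t))`, singular at the origin, satisfies
`R_{2α log λ} (λ u(λ²t, λ ·))(R_{−2α log λ} x) = u(t, x)` a.e. on the slab for every `λ > 0` (the hypothesis of
`Negative.RssApexFatal α`, verbatim). [cite: PineauVicol2026, Theorem 1.4 (arXiv:2607.09619 p. 4)] -/
theorem rssApexFatal_smallOrLargePitch :
    ∀ C : ℝ, 0 < C → ∃ α₁ α₂ : ℝ, 0 < α₁ ∧ 0 < α₂ ∧ ∀ α : ℝ, (|α| < α₁ ∨ α₂ < |α|) →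
      ∀ (u : ℝ → EuclideanSpace ℝ (Fin 3) → EuclideanSpace ℝ (Fin 3)) (p : ℝ → EuclideanSpace ℝ (Fin 3) → ℝ) (G : ℝ → EuclideanSpace ℝ (Fin 3) → EuclideanSpace ℝ (Fin 3) →L[ℝ] EuclideanSpace ℝ (Fin 3)),
        IsSuitableWeakSolutionOn (slab (EuclideanSpace ℝ (Fin 3)) (Iio (0 : ℝ)) isOpen_Iio) 1 0 u p → HasWeakSpatialGradientOn (slab (EuclideanSpace ℝ (Fin 3)) (Iio (0 : ℝ)) isOpen_Iio) u G → typeIBound (Iio (0 : ℝ) ×ˢ univ) u p G < ⊤ → HasTypeIDecay C u → IsBackwardSingularPoint u 0 →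
        (∀ lam : ℝ, 0 < lam →
          uncurry (conjZ (2 * α * Real.log lam) (nsRescale lam u)) =ᵐ[volume.restrict (Iio (0 : ℝ) ×ˢ (univ : Set (EuclideanSpace ℝ (Fin 3))))] uncurry u) → False := by
  intro C hC
  obtain ⟨α₁, α₂, hα₁, hα₂, hPV⟩ := pineauVicol2026_rss_liouville_holds C hC
  refine ⟨α₁, α₂, hα₁, hα₂, fun α hα u p G hsw hwg hI hdec hsing hrss => ?_⟩
  -- the Type-I ancient mild representative and a classical pressure
  obtain ⟨V, hae, hmild, hdecV⟩ := stub_apexMildRepresentative u p G C hC hsw hwg hI hdec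
  obtain ⟨Q, hcl⟩ := exists_isClassicalNSSolutionOn_Iio hmild
  have hcontV : ContinuousOn (uncurry V) (Iio (0 : ℝ) ×ˢ (univ : Set (EuclideanSpace ℝ (Fin 3)))) :=
    hmild.1.continuousOn
  -- the a.e. RSS identities transport to `V` and hold pointwise on the open slab
  have hVrss : ∀ lam : ℝ, 0 < lam → ∀ t : ℝ, t < 0 → ∀ x : EuclideanSpace ℝ (Fin 3),
      conjZ (2 * α * Real.log lam) (nsRescale lam V) t x = V t x := by
    intro lam hlam t ht x
    have haeV : uncurry (conjZ (2 * α * Real.log lam) (nsRescale lam V))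
        =ᵐ[volume.restrict (Iio (0 : ℝ) ×ˢ (univ : Set (EuclideanSpace ℝ (Fin 3))))] uncurry V :=
      ((conjZ_ae_eq_slab _ (nsRescale_ae_eq_slab hlam hae)).trans (hrss lam hlam)).trans hae.symm
    have heqOn : EqOn (uncurry (conjZ (2 * α * Real.log lam) (nsRescale lam V))) (uncurry V)
        (Iio (0 : ℝ) ×ˢ (univ : Set (EuclideanSpace ℝ (Fin 3)))) :=
      Measure.eqOn_open_of_ae_eq haeV (isOpen_Iio.prod isOpen_univ)
        (continuousOn_uncurry_conjZ _ (continuousOn_uncurry_nsRescale hlam hcontV)) hcontV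
    exact heqOn (mk_mem_prod ht (mem_univ x))
  -- `V` is the Pineau–Vicol ansatz of its smooth slice `U = V(−1, ·)`
  set U : EuclideanSpace ℝ (Fin 3) → EuclideanSpace ℝ (Fin 3) := V (-1) with hU
  have hans : ∀ t ∈ Ico (-1 : ℝ) 0, ∀ x : EuclideanSpace ℝ (Fin 3), V t x = pvAnsatz α (fun y _ => U y) t x :=
    fun t ht x => rss_pointwise_eq_pvAnsatz hVrss ht.2 x
  have hU2 : ContDiff ℝ 2 U :=
    (hcl.smooth_velocity.contDiff_slice (show (-1 : ℝ) ∈ Iio 0 by norm_num)).of_le (by norm_cast)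
  -- Theorem 1.4 on `[−1, 0)`
  have hcl' : IsClassicalNSSolutionOn (Ico (-1 : ℝ) 0) 1 0 V Q :=
    hcl.mono Ico_subset_Iio_self (uniqueDiffOn_Ico (-1) 0)
  have hI' : ∀ t ∈ Ico (-1 : ℝ) 0, ∀ x : EuclideanSpace ℝ (Fin 3), ‖V t x‖ ≤ C / (‖x‖ + Real.sqrt (-t)) :=
    fun t ht x => hdecV t ht.2 x
  have hU0 : U = 0 := hPV α V Q U hcl' hI' hU2 hans hα
  -- hence `V ≡ 0` on `t < 0`
  have hzero : ∀ t : ℝ, t < 0 → ∀ x : EuclideanSpace ℝ (Fin 3), V t x = 0 := by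
    intro t ht x
    rw [rss_pointwise_eq_pvAnsatz hVrss ht x]
    simp only [pvAnsatz, ← hU, hU0, Pi.zero_apply, rotZ_zero_vec', smul_zero]
  -- so `u = 0` a.e. on the slab, and the origin is not singular
  refine not_isBackwardSingularPoint_of_ae_zero_slab (u := u) ?_ hsing
  filter_upwards [hae, ae_restrict_mem (measurableSet_Iio.prod MeasurableSet.univ)] with w hw hmem
  rw [← hw]
  exact hzero w.1 hmem.1 w.2

/-- **The spiral world is confined to a compact band of pitches.**  If a singular apex profile with Type-I
constant `C` is a.e. `α`-RSS (the scenario of Disproof §4 / `Negative/SpiralWorld` in which `SymmetricScarExists`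
FAILS), then `α₁(C) ≤ |α| ≤ α₂(C)` with Pineau–Vicol's thresholds; together with `α = 0` (Tsai, `SelfSimilarApexFatal`)
only the mid-pitch window of Perelman's problem (Pineau–Vicol 2026, Conj. 1.1) remains open.
[cite: PineauVicol2026, Theorem 1.4 and Conjecture 1.1 (arXiv:2607.09619 pp. 3–4)] -/
theorem spiralWorld_pitch_window :
    ∀ C : ℝ, 0 < C → ∃ α₁ α₂ : ℝ, 0 < α₁ ∧ 0 < α₂ ∧ ∀ α : ℝ,
      ∀ (u : ℝ → EuclideanSpace ℝ (Fin 3) → EuclideanSpace ℝ (Fin 3)) (p : ℝ → EuclideanSpace ℝ (Fin 3) → ℝ) (G : ℝ → EuclideanSpace ℝ (Fin 3) → EuclideanSpace ℝ (Fin 3) →L[ℝ] EuclideanSpace ℝ (Fin 3)),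
        IsSuitableWeakSolutionOn (slab (EuclideanSpace ℝ (Fin 3)) (Iio (0 : ℝ)) isOpen_Iio) 1 0 u p → HasWeakSpatialGradientOn (slab (EuclideanSpace ℝ (Fin 3)) (Iio (0 : ℝ)) isOpen_Iio) u G → typeIBound (Iio (0 : ℝ) ×ˢ univ) u p G < ⊤ → HasTypeIDecay C u → IsBackwardSingularPoint u 0 →
        (∀ lam : ℝ, 0 < lam →
          uncurry (conjZ (2 * α * Real.log lam) (nsRescale lam u)) =ᵐ[volume.restrict (Iio (0 : ℝ) ×ˢ (univ : Set (EuclideanSpace ℝ (Fin 3))))] uncurry u) →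
        α₁ ≤ |α| ∧ |α| ≤ α₂ := by
  intro C hC
  obtain ⟨α₁, α₂, hα₁, hα₂, H⟩ := rssApexFatal_smallOrLargePitch C hC
  refine ⟨α₁, α₂, hα₁, hα₂, fun α u p G hsw hwg hI hdec hsing hrss => ?_⟩
  by_contra hband
  rw [not_and_or, not_le, not_le] at hband
  exact H α hband u p G hsw hwg hI hdec hsing hrss

end Summit.NavierStokesRegularity.NavierStokesRegularity.Theorems.SymmetricScarExists.ScarWindow

end
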